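import Mathlib
import HarnessLib
import Summits.RiemannHypothesis.Statement
import Summits.RiemannHypothesis.RiemannHypothesis.Theses.MayerPairing
import Summits.RiemannHypothesis.RiemannHypothesis.Theorems.MayerPairingTarget

/-!
# RiemannHypothesis / MayerPairing — bulging eigenvalue selections refute the monotonicity crux

Route `RiemannHypothesis/MayerPairing`, helper file for item stmt-RiemannHypothesis-1473
(`Target = UnitCircleCrossedOnce ∧ BranchPairing`).

The monotonicity crux `UnitCircleCrossedOnce` (item 1470) forbids a continuous eigenvalue
selection `σ ↦ Λ σ` of Mayer's `L_{σ+iτ}` (`|τ| ≥ 7`) with MODULUS EXACTLY `1` at both ends of an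
interval `[a, b] ⊂ (0, 1/2)`. The numerical witnesses against it recorded on items 1470/1473
(τ ≈ 24.00: `|Λ| = 0.9886 ↗ 1.4036 ↘ 0.7664`; τ ≈ 37.85: `0.9211 ↗ 1.0921 ↘ 0.8879`) are
certified as strict INEQUALITIES with margins `≥ 0.08`, not as equalities. This file records the
(elementary, intermediate-value) interface between the two: a continuous eigenvalue selection on
`[a, b] ⊂ (0, 1/2)` whose modulus is `< 1`, `> 1`, `< 1` at three points `a < m < b` ("bulge"), or
`> 1`, `< 1`, `> 1` ("dip"), already contradicts `UnitCircleCrossedOnce`, hence `Target`; and a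
selection starting at the exact eigenvalue `1` whose modulus later takes values on both sides of
`1` contradicts the weaker exact-left form W1 (hypothesis of
`mayerPairing_riemannHypothesis_of_exactLeft`). All statements inline the route's eigenvalue
predicate verbatim; no definitions.

* `mayerPairing_not_unitCircleCrossedOnce_of_bulge`, `mayerPairing_not_unitCircleCrossedOnce_of_dip`,
* `mayerPairing_not_target_of_bulge`,
* `mayerPairing_not_exactLeft_of_sign_change`.
-/

namespace Summit.RiemannHypothesis.RiemannHypothesis.Theorems

open Filter Topology
open Summit.RiemannHypothesis.RiemannHypothesis.Theses.MayerPairing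

/-- Intermediate-value step: a function continuous on `[a, b]` whose norm is `< 1` at one end and
`> 1` at the other has norm exactly `1` at an INTERIOR point. [folklore] -/
theorem mayerPairing_exists_norm_eq_one {Λ : ℝ → ℂ} {a b : ℝ} (hab : a ≤ b)
    (hΛ : ContinuousOn Λ (Set.Icc a b))
    (h : (‖Λ a‖ < 1 ∧ 1 < ‖Λ b‖) ∨ (1 < ‖Λ a‖ ∧ ‖Λ b‖ < 1)) :
    ∃ c, a < c ∧ c < b ∧ ‖Λ c‖ = 1 := by
  have hg : ContinuousOn (fun σ => ‖Λ σ‖) (Set.Icc a b) := hΛ.norm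
  rcases h with ⟨h1, h2⟩ | ⟨h1, h2⟩
  · obtain ⟨c, ⟨hac, hcb⟩, hc⟩ := intermediate_value_Icc hab hg ⟨h1.le, h2.le⟩
    refine ⟨c, lt_of_le_of_ne hac ?_, lt_of_le_of_ne hcb ?_, hc⟩
    · rintro rfl; simp only [hc] at h1; exact lt_irrefl _ h1
    · rintro rfl; simp only [hc] at h2; exact lt_irrefl _ h2
  · obtain ⟨c, ⟨hac, hcb⟩, hc⟩ := intermediate_value_Icc' hab hg ⟨h2.le, h1.le⟩
    refine ⟨c, lt_of_le_of_ne hac ?_, lt_of_le_of_ne hcb ?_, hc⟩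
    · rintro rfl; simp only [hc] at h1; exact lt_irrefl _ h1
    · rintro rfl; simp only [hc] at h2; exact lt_irrefl _ h2

/-- **A bulging eigenvalue selection refutes `UnitCircleCrossedOnce`.** If at some height
`|τ| ≥ 7` a continuous selection `Λ` of eigenvalues of Mayer's `L_{σ+iτ}` (inlined predicate) on
`[a, b] ⊂ (0, 1/2)` has `‖Λ a‖ < 1 < ‖Λ m‖` and `‖Λ b‖ < 1` for some `a < m < b`, then by the
intermediate value theorem `‖Λ‖ = 1` at some `a' ∈ (a, m)` and some `b' ∈ (m, b)`, and `Λ|[a', b']`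
violates the crux. (This is the shape of the numerical witnesses on items 1470/1473.) [folklore] -/
theorem mayerPairing_not_unitCircleCrossedOnce_of_bulge
    (h : ∃ τ : ℝ, 7 ≤ |τ| ∧ ∃ a m b : ℝ, 0 < a ∧ a < m ∧ m < b ∧ b < 1 / 2 ∧ ∃ Λ : ℝ → ℂ,
      ContinuousOn Λ (Set.Icc a b) ∧
      (∀ σ ∈ Set.Icc a b, ∃ f : ℂ → ℂ, ∃ δ : ℝ, 0 < δ ∧ DifferentiableOn ℂ f {z : ℂ | -δ < z.re} ∧
        (∃ z : ℂ, 0 < z.re ∧ f z ≠ 0) ∧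
        (∀ z : ℂ, -δ < z.re → Λ σ * (f z - f (z + 1)) =
          (z + 1) ^ (-(2 * ((σ : ℂ) + (τ : ℂ) * Complex.I))) * f (1 / (z + 1))) ∧
        Tendsto (fun x : ℝ => Λ σ * f x -
          f 0 * ((x : ℂ) + 1) ^ (1 - 2 * ((σ : ℂ) + (τ : ℂ) * Complex.I)) /
          (2 * ((σ : ℂ) + (τ : ℂ) * Complex.I) - 1)) atTop (𝓝 0)) ∧
      ‖Λ a‖ < 1 ∧ 1 < ‖Λ m‖ ∧ ‖Λ b‖ < 1) :
    ¬ UnitCircleCrossedOnce := by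
  intro hU
  obtain ⟨τ, hτ, a, m, b, ha, ham, hmb, hb, Λ, hΛ, heig, h1, h2, h3⟩ := h
  obtain ⟨a', haa', ha'm, ha'⟩ := mayerPairing_exists_norm_eq_one ham.le
    (hΛ.mono (Set.Icc_subset_Icc le_rfl hmb.le)) (Or.inl ⟨h1, h2⟩)
  obtain ⟨b', hmb', hb'b, hb'⟩ := mayerPairing_exists_norm_eq_one hmb.le
    (hΛ.mono (Set.Icc_subset_Icc ham.le le_rfl)) (Or.inr ⟨h2, h3⟩)
  have hsub : Set.Icc a' b' ⊆ Set.Icc a b := Set.Icc_subset_Icc haa'.le hb'b.le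
  exact hU τ hτ a' b' (ha.trans haa') (ha'm.trans hmb') (hb'b.trans hb) Λ (hΛ.mono hsub)
    (fun σ hσ => heig σ (hsub hσ)) ⟨ha', hb'⟩

/-- **A dipping eigenvalue selection refutes `UnitCircleCrossedOnce`** (`‖Λ a‖ > 1 > ‖Λ m‖`,
`‖Λ b‖ > 1`, `a < m < b`): same intermediate-value argument. [folklore] -/
theorem mayerPairing_not_unitCircleCrossedOnce_of_dip
    (h : ∃ τ : ℝ, 7 ≤ |τ| ∧ ∃ a m b : ℝ, 0 < a ∧ a < m ∧ m < b ∧ b < 1 / 2 ∧ ∃ Λ : ℝ → ℂ,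
      ContinuousOn Λ (Set.Icc a b) ∧
      (∀ σ ∈ Set.Icc a b, ∃ f : ℂ → ℂ, ∃ δ : ℝ, 0 < δ ∧ DifferentiableOn ℂ f {z : ℂ | -δ < z.re} ∧
        (∃ z : ℂ, 0 < z.re ∧ f z ≠ 0) ∧
        (∀ z : ℂ, -δ < z.re → Λ σ * (f z - f (z + 1)) =
          (z + 1) ^ (-(2 * ((σ : ℂ) + (τ : ℂ) * Complex.I))) * f (1 / (z + 1))) ∧
        Tendsto (fun x : ℝ => Λ σ * f x -
          f 0 * ((x : ℂ) + 1) ^ (1 - 2 * ((σ : ℂ) + (τ : ℂ) * Complex.I)) /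
          (2 * ((σ : ℂ) + (τ : ℂ) * Complex.I) - 1)) atTop (𝓝 0)) ∧
      1 < ‖Λ a‖ ∧ ‖Λ m‖ < 1 ∧ 1 < ‖Λ b‖) :
    ¬ UnitCircleCrossedOnce := by
  intro hU
  obtain ⟨τ, hτ, a, m, b, ha, ham, hmb, hb, Λ, hΛ, heig, h1, h2, h3⟩ := h
  obtain ⟨a', haa', ha'm, ha'⟩ := mayerPairing_exists_norm_eq_one ham.le
    (hΛ.mono (Set.Icc_subset_Icc le_rfl hmb.le)) (Or.inr ⟨h1, h2⟩)
  obtain ⟨b', hmb', hb'b, hb'⟩ := mayerPairing_exists_norm_eq_one hmb.le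
    (hΛ.mono (Set.Icc_subset_Icc ham.le le_rfl)) (Or.inl ⟨h2, h3⟩)
  have hsub : Set.Icc a' b' ⊆ Set.Icc a b := Set.Icc_subset_Icc haa'.le hb'b.le
  exact hU τ hτ a' b' (ha.trans haa') (ha'm.trans hmb') (hb'b.trans hb) Λ (hΛ.mono hsub)
    (fun σ hσ => heig σ (hsub hσ)) ⟨ha', hb'⟩

/-- **A bulging eigenvalue selection refutes the target** `Target = UnitCircleCrossedOnce ∧
BranchPairing` of the route (item 1473). [folklore] -/
theorem mayerPairing_not_target_of_bulge
    (h : ∃ τ : ℝ, 7 ≤ |τ| ∧ ∃ a m b : ℝ, 0 < a ∧ a < m ∧ m < b ∧ b < 1 / 2 ∧ ∃ Λ : ℝ → ℂ,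
      ContinuousOn Λ (Set.Icc a b) ∧
      (∀ σ ∈ Set.Icc a b, ∃ f : ℂ → ℂ, ∃ δ : ℝ, 0 < δ ∧ DifferentiableOn ℂ f {z : ℂ | -δ < z.re} ∧
        (∃ z : ℂ, 0 < z.re ∧ f z ≠ 0) ∧
        (∀ z : ℂ, -δ < z.re → Λ σ * (f z - f (z + 1)) =
          (z + 1) ^ (-(2 * ((σ : ℂ) + (τ : ℂ) * Complex.I))) * f (1 / (z + 1))) ∧
        Tendsto (fun x : ℝ => Λ σ * f x -
          f 0 * ((x : ℂ) + 1) ^ (1 - 2 * ((σ : ℂ) + (τ : ℂ) * Complex.I)) /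
          (2 * ((σ : ℂ) + (τ : ℂ) * Complex.I) - 1)) atTop (𝓝 0)) ∧
      ‖Λ a‖ < 1 ∧ 1 < ‖Λ m‖ ∧ ‖Λ b‖ < 1) :
    ¬ Target :=
  mayerPairing_not_target_of_not_unitCircleCrossedOnce
    (mayerPairing_not_unitCircleCrossedOnce_of_bulge h)

/-- **What refutes the exact-left form W1.** If a continuous eigenvalue selection on
`[a, b] ⊂ (0, 1/2)` (`|τ| ≥ 7`) STARTS at the exact eigenvalue `Λ a = 1` and its modulus later
takes values on both sides of `1` (at `m < b'` in `(a, b]`: a bulge `1 < ‖Λ m‖, ‖Λ b'‖ < 1` or a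
dip-and-recover `‖Λ m‖ < 1 < ‖Λ b'‖`), then `‖Λ‖ = 1` somewhere in `(m, b')` and the exact-left
form W1 (hypothesis `h` of `mayerPairing_riemannHypothesis_of_exactLeft`) fails. At zero heights
`τ = γ_k/2`, `a = 1/4`, this is the kill test for W1 recorded on item 1473 (alive for `k ≤ 30`).
[folklore] -/
theorem mayerPairing_not_exactLeft_of_sign_change
    (h : ∃ τ : ℝ, 7 ≤ |τ| ∧ ∃ a m b : ℝ, 0 < a ∧ a < m ∧ m < b ∧ b < 1 / 2 ∧ ∃ Λ : ℝ → ℂ,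
      ContinuousOn Λ (Set.Icc a b) ∧
      (∀ σ ∈ Set.Icc a b, ∃ f : ℂ → ℂ, ∃ δ : ℝ, 0 < δ ∧ DifferentiableOn ℂ f {z : ℂ | -δ < z.re} ∧
        (∃ z : ℂ, 0 < z.re ∧ f z ≠ 0) ∧
        (∀ z : ℂ, -δ < z.re → Λ σ * (f z - f (z + 1)) =
          (z + 1) ^ (-(2 * ((σ : ℂ) + (τ : ℂ) * Complex.I))) * f (1 / (z + 1))) ∧
        Tendsto (fun x : ℝ => Λ σ * f x -
          f 0 * ((x : ℂ) + 1) ^ (1 - 2 * ((σ : ℂ) + (τ : ℂ) * Complex.I)) /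
          (2 * ((σ : ℂ) + (τ : ℂ) * Complex.I) - 1)) atTop (𝓝 0)) ∧
      Λ a = 1 ∧ ((‖Λ m‖ < 1 ∧ 1 < ‖Λ b‖) ∨ (1 < ‖Λ m‖ ∧ ‖Λ b‖ < 1))) :
    ¬ (∀ τ : ℝ, 7 ≤ |τ| → ∀ a b : ℝ, 0 < a → a < b → b < 1 / 2 → ∀ Λ : ℝ → ℂ,
      ContinuousOn Λ (Set.Icc a b) →
      (∀ σ ∈ Set.Icc a b, ∃ f : ℂ → ℂ, ∃ δ : ℝ, 0 < δ ∧ DifferentiableOn ℂ f {z : ℂ | -δ < z.re} ∧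
        (∃ z : ℂ, 0 < z.re ∧ f z ≠ 0) ∧
        (∀ z : ℂ, -δ < z.re → Λ σ * (f z - f (z + 1)) =
          (z + 1) ^ (-(2 * ((σ : ℂ) + (τ : ℂ) * Complex.I))) * f (1 / (z + 1))) ∧
        Tendsto (fun x : ℝ => Λ σ * f x -
          f 0 * ((x : ℂ) + 1) ^ (1 - 2 * ((σ : ℂ) + (τ : ℂ) * Complex.I)) /
          (2 * ((σ : ℂ) + (τ : ℂ) * Complex.I) - 1)) atTop (𝓝 0)) →
      ¬ (Λ a = 1 ∧ ‖Λ b‖ = 1)) := by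
  intro hW
  obtain ⟨τ, hτ, a, m, b, ha, ham, hmb, hb, Λ, hΛ, heig, h1, hmix⟩ := h
  obtain ⟨b', hmb', hb'b, hb'⟩ := mayerPairing_exists_norm_eq_one hmb.le
    (hΛ.mono (Set.Icc_subset_Icc ham.le le_rfl)) hmix
  have hsub : Set.Icc a b' ⊆ Set.Icc a b := Set.Icc_subset_Icc le_rfl hb'b.le
  exact hW τ hτ a b' ha (ham.trans hmb') (hb'b.trans hb) Λ (hΛ.mono hsub)
    (fun σ hσ => heig σ (hsub hσ)) ⟨h1, hb'⟩

end Summit.RiemannHypothesis.RiemannHypothesis.Theorems
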